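import Mathlib
import Summits.Ventures.HodgeRepro.Tier4.Common.AdelicDefs
import Summits.Ventures.HodgeRepro.Tier4.Common.CongruenceAdeles
import Summits.Ventures.HodgeRepro.Tier4.Common.CompactOpenLevel
import Summits.Ventures.HodgeRepro.Tier4.Line1.AdelicParts
import Summits.Ventures.HodgeRepro.Tier4.Line4.LevelCosetCongruence
import Summits.Ventures.HodgeRepro.Tier4.Line4.IntegralTransport

/-!
# Tier4/Line4/RationalDenominator — every rational point has a natural denominator `D` with `D • mat γ` finite-integral
(the `hD` binder of OrbitInvariantDenominator)

Blind re-derivation cell `pub-hodge-repro`, Tier 4 «prove the step» (README §9–§10), seat t4-L1-p3 (gen 4).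
Tree path `lean/Summits/Ventures/HodgeRepro/Tier4/Line4/RationalDenominator.lean`.

`exists_nat_mul_mem_ringOfIntegers`: every `x ∈ k` has `D ∈ ℕ`, `D ≠ 0`, with `D x ∈ 𝓞_k` (Mathlib's
`exists_integral_multiple` over `ℤ`, `k` algebraic over `ℤ` through `ℚ`).  `exists_nat_smul_isIntegralFinMat_of_mem_rationalPoints`:
for a rational point `γ` of `G(𝔸_k)` there is `D ∈ ℕ`, `D ≠ 0`, with `(D : 𝔸_k) • GA.mat W γ` finite-integral (the
product of the 16 entry denominators) — the `hD` binder of OrbitInvariantDenominator, so the off-fibre read-out holds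
for EVERY rational `γ₀` with its own `D`.  No printed input.  HC_CM is NOT proved by anyone in this repository.
-/

namespace Summit.Ventures.HodgeRepro.Tier4.Line4

open Summit.Ventures.HodgeRepro.Tier4.Common Summit.Ventures.HodgeRepro.Tier4.Line1 NumberField Matrix
open scoped NumberField

section Denominator

variable {k : Type} [Field k] [NumberField k]

/-- Every element of a number field has a non-zero natural denominator. -/
theorem exists_nat_mul_mem_ringOfIntegers (x : k) : ∃ D : ℕ, D ≠ 0 ∧ ∃ z : 𝓞 k, (D : k) * x = z := by
  have halg : IsAlgebraic ℤ x :=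
    (IsFractionRing.isAlgebraic_iff ℤ ℚ k).mpr (Algebra.IsAlgebraic.isAlgebraic x)
  obtain ⟨y, hy0, hy⟩ := halg.exists_integral_multiple
  obtain ⟨z, hz⟩ := (IsIntegralClosure.isIntegral_iff (A := 𝓞 k)).mp hy
  refine ⟨y.natAbs, Int.natAbs_ne_zero.mpr hy0, ?_⟩
  rw [zsmul_eq_mul] at hz
  have hz' : ((z : 𝓞 k) : k) = (y : k) * x := hz
  rcases le_or_gt 0 y with hy' | hy'
  · refine ⟨z, ?_⟩
    have hc : ((y.natAbs : ℕ) : k) = (y : k) := by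
      rw [← Int.cast_natCast, Int.natAbs_of_nonneg hy']
    rw [hc, hz']
  · refine ⟨-z, ?_⟩
    have hc : ((y.natAbs : ℕ) : k) = -(y : k) := by
      rw [← Int.cast_natCast, Int.ofNat_natAbs_of_nonpos hy'.le, Int.cast_neg]
    rw [hc, RingOfIntegers.coe_eq_algebraMap, map_neg, ← RingOfIntegers.coe_eq_algebraMap, hz']
    ring

omit [NumberField k] in
/-- A natural multiple of an integer of `k` is an integer of `k`. -/
theorem nat_mul_mem_ringOfIntegers (n : ℕ) (z : 𝓞 k) : ∃ z' : 𝓞 k, (n : k) * z = z' :=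
  ⟨(n : 𝓞 k) * z, by push_cast; ring⟩

/-- **Every rational point has a natural denominator**: `D ≠ 0` with `(D : 𝔸_k) • GA.mat W γ` finite-integral. -/
theorem exists_nat_smul_isIntegralFinMat_of_mem_rationalPoints (W : PlaneData k) {γ : GA W}
    (hγ : γ ∈ rationalPoints W) : ∃ D : ℕ, D ≠ 0 ∧ IsIntegralFinMat ((D : Ad k) • GA.mat W γ) := by
  obtain ⟨m, hm⟩ := exists_rational_mat_of_mem_rationalPoints W hγ
  choose d hd0 hd using fun p : Fin 4 × Fin 4 => exists_nat_mul_mem_ringOfIntegers (m p.1 p.2)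
  refine ⟨∏ p : Fin 4 × Fin 4, d p, Finset.prod_ne_zero_iff.mpr fun p _ => hd0 p, ?_⟩
  have hentry : ∀ i j, ∃ z : 𝓞 k, ((∏ p : Fin 4 × Fin 4, d p : ℕ) : k) * m i j = z := by
    intro i j
    obtain ⟨z, hz⟩ := hd (i, j)
    rw [← Finset.mul_prod_erase Finset.univ d (Finset.mem_univ (i, j))]
    obtain ⟨z', hz'⟩ := nat_mul_mem_ringOfIntegers (∏ p ∈ Finset.univ.erase (i, j), d p) z
    refine ⟨z', ?_⟩
    rw [Nat.cast_mul, mul_comm ((d (i, j) : k)), mul_assoc, hz, hz']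
  intro i j
  obtain ⟨z, hz⟩ := hentry i j
  have h : ((((∏ p : Fin 4 × Fin 4, d p) : ℕ) : Ad k) • GA.mat W γ) i j = algebraMap k (Ad k) (z : k) := by
    rw [hm, Matrix.smul_apply, Matrix.map_apply, smul_eq_mul, ← hz, map_mul, map_natCast]
  rw [h]
  exact finPart_algebraMap_mem_integralSet z

end Denominator

end Summit.Ventures.HodgeRepro.Tier4.Line4
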